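/-
Copyright (c) 2026 the pub-hodgecm-mathlib formalisation cell (harness21).  Prover seat hodgecm-mathlib-K2E3-p25 (g2), HCML Track B «K2-LIT»,
h413 = `stmt-HodgeConjecture-24833`, road (11-3-split-nsc), leaf (nsc-S-A′) `sig_K2E3GL3PrincipalBlockStandardSpan` (U12 :463), brick PEEL (file 1 of 3) of the leaf
owner's `K2/K2E3-p25/g2/MEMO-SA-architecture.v2.K2E3-p25-g2.md` §2 (feed (B) of H0).  2026-09-04.
-/
import Summits.HodgeConjecture.HodgeConjecture.Theorems.K2E3GL2JacquetExponents   -- ★ G1 (c): brings ★ G1 files 1–2, ★ E1a, ★ E1b, ★ Frobenius, ★ Jacquet exactness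
import Mathlib.GroupTheory.NoncommCoprod
import HarnessLib

/-!
# K2_E3 road (h413), leaf (nsc-S-A′), brick PEEL (file 1 of 3) — the `T₂ × D`-module structure of the Jacquet module of a `GL₂(F)`-representation with a
# commuting action; right exactness of coinvariants in «class formula» form

Cell `pub/hodgecm-mathlib` (D-0151), Track B, seat K2E3-p25 (g2) (leaf owner ∕ architect).  `--supports stmt-HodgeConjecture-24833 --as helper`; THEOREMS ONLY
(no `def`, no instance, no notation, no `sorry`); never imports `Cruxes/…/Lines`.  COUNT-NEUTRAL.

THE SETTING (files 1–3).  `F` a non-archimedean local field, `G₂ = GL₂(F)`, `B₂ = Q_{1,1} = standardParabolicGL F (lastBlockLabel 2)`, `T₂ = Π a : Bool, GL {i // lastBlockLabel 2 i = a} F`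
its Levi, `I₂ x y = parabolicIndGL F (lastBlockLabel 2) (𝟙.twist (maxParabolicLeviChar F 2 x y))` (★ G1 currency), `D` ANY group whose elements commute (in the application
`D = GL₁(F)`, the third block of the torus of `GL₃(F)`), `W : Representation ℂ G₂ X` smooth and `ζ : Representation ℂ D X` COMMUTING with `W`.  The `U₂`-coinvariants
`C(X)` of `W` carry the normalised Jacquet action `r(t)` of `T₂` (★ `normalizedJacquetGL`) AND the descended `D`-action; this file shows that a representation `τ` of
`T₂ × D` on `C(X)` with `τ (t,1) = r(t)` and `τ (1,d) [v] = [ζ d v]` EXISTS (`exists_prodRep`) and satisfies the class formula `τ (t,d) [v] = δ^{-1∕2}(t) • [W (diag t) (ζ d v)]`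
(`prodRep_apply_mk`), and records the right exactness of coinvariants along `0 → K → X → Y → 0` in the form consumed by the peeling step (`exact_of_mk_comp`).
Files 2–3 (`K2E3GL2JacquetPeelingStep`, `K2E3GL2JacquetPeelingRules`): the Frobenius peeling step and the rules (swap symmetry, parity) of the leaf's exponent calculus.
[BernsteinZelevinsky1977, Prop. 1.9, §2.3, Cor. 2.13; Casselman1995, Thm. 3.2.4, §6.3]

HONEST LABEL: HC_CM is proved only modulo the 7 printed citations (2 remaining named inputs: hLiu418 = stmt-HodgeConjecture-24832, h413 = stmt-HodgeConjecture-24833) until rung 0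
closes; count-neutral generic helper.

## References
* [BernsteinZelevinsky1977] I. N. Bernstein, A. V. Zelevinsky, *Induced representations of reductive p-adic groups I*, Ann. Sci. ÉNS 10 (1977), Prop. 1.9, §2.3, Cor. 2.13, Thm. 2.5, 5.2.
* [Casselman1995] W. Casselman, *Introduction to the theory of admissible representations of p-adic reductive groups* (draft 1 May 1995), Thm. 3.2.4, §4.4, §6.3, Lemma 7.1.1.
-/

set_option autoImplicit false
set_option linter.dupNamespace false

noncomputable section

open Module Module.End Function
open scoped MatrixGroups
open Literature.NumberTheory.Automorphic Literature.NumberTheory.Automorphic.Zelevinsky1980 ValuativeRel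
open Summit.HodgeConjecture.HodgeConjecture.Cruxes.H413.K2E3GL2JacquetModuleStructure
open Summit.HodgeConjecture.HodgeConjecture.Cruxes.H413.K2E3GL2JacquetExponents
open Summit.HodgeConjecture.HodgeConjecture.Cruxes.H413.K2E3JacquetExponentMultiset
open Summit.HodgeConjecture.HodgeConjecture.Cruxes.H413.K2E3JacquetExponentEigenvector

namespace Summit.HodgeConjecture.HodgeConjecture.Cruxes.H413.K2E3GL2JacquetProdRep

/-! ## §0 Right exactness of coinvariants along `0 → K → X → Y → 0`, in «class formula» form -/

section Exact

variable {k S : Type*} [CommRing k] [Monoid S] {V₁ V₂ V₃ : Type*} [AddCommGroup V₁] [Module k V₁] [AddCommGroup V₂] [Module k V₂]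
  [AddCommGroup V₃] [Module k V₃]

/-- **Coinvariants are exact in the middle along `V₁ →ι V₂ →Φ V₃` with `Φ` equivariant and surjective** — for ANY linear maps `j₁, j₂` between the coinvariant
spaces given by the class formulas `j₁ [v] = [ι v]`, `j₂ [v] = [Φ v]`: a generator `σ₃(s) w − w` of the relations of `V₃` lifts to `σ₂(s) u − u`.
[cite: BernsteinZelevinsky1977, Prop. 1.9 (a), §2.3] -/
theorem exact_of_mk_comp (σ₁ : Representation k S V₁) (σ₂ : Representation k S V₂) (σ₃ : Representation k S V₃)
    (ι : V₁ →ₗ[k] V₂) (Φ : σ₂.IntertwiningMap σ₃) (hex : Function.Exact ι Φ) (hΦ : Function.Surjective Φ)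
    (j₁ : σ₁.Coinvariants →ₗ[k] σ₂.Coinvariants) (j₂ : σ₂.Coinvariants →ₗ[k] σ₃.Coinvariants)
    (hj₁ : ∀ v, j₁ (Representation.Coinvariants.mk σ₁ v) = Representation.Coinvariants.mk σ₂ (ι v))
    (hj₂ : ∀ v, j₂ (Representation.Coinvariants.mk σ₂ v) = Representation.Coinvariants.mk σ₃ (Φ v)) :
    Function.Exact j₁ j₂ := by
  -- the relations of `V₃` lift to relations of `V₂`
  have hlift : Representation.Coinvariants.ker σ₃ ≤ (Representation.Coinvariants.ker σ₂).map Φ.toLinearMap := by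
    refine Submodule.span_le.2 ?_
    rintro _ ⟨⟨s, w⟩, rfl⟩
    obtain ⟨u, rfl⟩ := hΦ w
    refine ⟨σ₂ s u - u, Representation.Coinvariants.sub_mem_ker s u, ?_⟩
    change Φ (σ₂ s u - u) = σ₃ s (Φ u) - Φ u
    rw [map_sub, Φ.isIntertwining]
  intro c
  constructor
  · intro hc
    obtain ⟨v, rfl⟩ := Representation.Coinvariants.mk_surjective σ₂ c
    rw [hj₂, Representation.Coinvariants.mk_eq_zero] at hc
    obtain ⟨y', hy', hy'v⟩ := hlift hc
    have h0 : Φ (v - y') = 0 := by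
      rw [map_sub, sub_eq_zero]
      exact hy'v.symm
    obtain ⟨u, hu⟩ := (hex _).1 h0
    refine ⟨Representation.Coinvariants.mk σ₁ u, ?_⟩
    rw [hj₁, hu, map_sub, (Representation.Coinvariants.mk_eq_zero σ₂).2 hy', sub_zero]
  · rintro ⟨c', rfl⟩
    obtain ⟨u, rfl⟩ := Representation.Coinvariants.mk_surjective σ₁ c'
    rw [hj₁, hj₂, hex.apply_apply_eq_zero, map_zero]

end Exact

/-! ## §1 The `T₂ × D`-module structure of the Jacquet module of a `GL₂(F) × D`-representation -/

section ProdRep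

variable {F : Type} [Field F] [ValuativeRel F] [TopologicalSpace F] [IsNonarchimedeanLocalField F]
variable {D : Type} [Group D]

omit [ValuativeRel F] [TopologicalSpace F] [IsNonarchimedeanLocalField F] in
/-- If the elements of `D` commute then `T₂ × D` is commutative (★ G1 `levi_mul_comm`). [cite: BernsteinZelevinsky1977, §2.1] -/
theorem prod_mul_comm (hD : ∀ d d' : D, d * d' = d' * d) (p q : (Π a : Bool, GL {i : Fin 2 // lastBlockLabel 2 i = a} F) × D) : p * q = q * p :=
  Prod.ext (levi_mul_comm p.1 q.1) (hD p.2 q.2)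

omit [ValuativeRel F] [TopologicalSpace F] [IsNonarchimedeanLocalField F] in
/-- A representation of the commutative group `T₂ × D` acts by pairwise commuting operators. [cite: BernsteinZelevinsky1977, §2.3] -/
theorem commute_prodRep (hD : ∀ d d' : D, d * d' = d' * d) {C : Type*} [AddCommGroup C] [Module ℂ C]
    (τ : Representation ℂ ((Π a : Bool, GL {i : Fin 2 // lastBlockLabel 2 i = a} F) × D) C)
    (p q : (Π a : Bool, GL {i : Fin 2 // lastBlockLabel 2 i = a} F) × D) : Commute (τ p) (τ q) := by
  change _ * _ = _ * _
  rw [← map_mul, prod_mul_comm hD, map_mul]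

variable {X : Type} [AddCommGroup X] [Module ℂ X]

/-- **The class formula.**  For a `GL₂(F)`-representation `W` and a commuting `D`-action `ζ`, a `T₂ × D`-action `τ` on the `U₂`-coinvariants of `W` with `τ (t,1) = r(t)`
(normalised Jacquet action) and `τ (1,d) [v] = [ζ d v]` satisfies `τ (t,d) [v] = δ^{-1∕2}(t) • [W (diag t) (ζ d v)]`. [cite: BernsteinZelevinsky1977, §2.3] -/
theorem prodRep_apply_mk (W : Representation ℂ (GL (Fin 2) F) X) (ζ : Representation ℂ D X)
    (τ : Representation ℂ ((Π a : Bool, GL {i : Fin 2 // lastBlockLabel 2 i = a} F) × D) (Representation.restrictUnipotentGL F (lastBlockLabel 2) W).Coinvariants)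
    (hτ₁ : ∀ t, τ (t, 1) = Representation.normalizedJacquetGL F (lastBlockLabel 2) W t)
    (hτ₂ : ∀ d v, τ (1, d) (Representation.Coinvariants.mk _ v) = Representation.Coinvariants.mk _ (ζ d v))
    (t : Π a : Bool, GL {i : Fin 2 // lastBlockLabel 2 i = a} F) (d : D) (v : X) :
    τ (t, d) (Representation.Coinvariants.mk _ v) =
      (((rootDeltaChar (standardParabolicGL F (lastBlockLabel 2)) (leviEmbeddingP F (lastBlockLabel 2) t))⁻¹ : ℂˣ) : ℂ) •
        Representation.Coinvariants.mk _ (W (blockDiagonalGL F (lastBlockLabel 2) t) (ζ d v)) := by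
  rw [← Prod.fst_mul_snd (t, d), map_mul, Module.End.mul_apply, hτ₂, hτ₁, Representation.normalizedJacquetGL_mk]

/-- **Existence of the `T₂ × D`-module structure** on the Jacquet module of `W`: a `D`-action `ζ` commuting with `W` descends to the `U₂`-coinvariants and commutes there
with the normalised Jacquet action of `T₂`. [cite: BernsteinZelevinsky1977, §2.3] -/
theorem exists_prodRep (W : Representation ℂ (GL (Fin 2) F) X) (ζ : Representation ℂ D X) (hWζ : ∀ g d, W g * ζ d = ζ d * W g) :
    ∃ τ : Representation ℂ ((Π a : Bool, GL {i : Fin 2 // lastBlockLabel 2 i = a} F) × D) (Representation.restrictUnipotentGL F (lastBlockLabel 2) W).Coinvariants,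
      (∀ t, τ (t, 1) = Representation.normalizedJacquetGL F (lastBlockLabel 2) W t) ∧
      (∀ d v, τ (1, d) (Representation.Coinvariants.mk _ v) = Representation.Coinvariants.mk _ (ζ d v)) := by
  -- `ζ d` commutes with the unipotent action
  let ζU : D → (Representation.restrictUnipotentGL F (lastBlockLabel 2) W).IntertwiningMap (Representation.restrictUnipotentGL F (lastBlockLabel 2) W) := fun d =>
    ⟨ζ d, fun u => (hWζ _ d).symm⟩
  -- the descended `D`-action
  let ζbar : D →* Module.End ℂ (Representation.restrictUnipotentGL F (lastBlockLabel 2) W).Coinvariants :=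
    { toFun := fun d => Representation.Coinvariants.map _ _ (ζU d)
      map_one' := by
        refine Representation.Coinvariants.hom_ext (LinearMap.ext fun v => ?_)
        change Representation.Coinvariants.mk (Representation.restrictUnipotentGL F (lastBlockLabel 2) W) (ζ 1 v) =
          Representation.Coinvariants.mk (Representation.restrictUnipotentGL F (lastBlockLabel 2) W) v
        rw [ζ.map_one]
        rfl
      map_mul' := fun d d' => by
        refine Representation.Coinvariants.hom_ext (LinearMap.ext fun v => ?_)
        change Representation.Coinvariants.mk (Representation.restrictUnipotentGL F (lastBlockLabel 2) W) (ζ (d * d') v) =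
          Representation.Coinvariants.mk (Representation.restrictUnipotentGL F (lastBlockLabel 2) W) (ζ d (ζ d' v))
        rw [ζ.map_mul]
        rfl }
  have hζbar : ∀ d v, ζbar d (Representation.Coinvariants.mk _ v) = Representation.Coinvariants.mk (Representation.restrictUnipotentGL F (lastBlockLabel 2) W) (ζ d v) :=
    fun d v => rfl
  -- it commutes with the normalised Jacquet action
  have hcomm : ∀ t d, Commute (Representation.normalizedJacquetGL F (lastBlockLabel 2) W t) (ζbar d) := by
    intro t d
    change _ * _ = _ * _
    refine Representation.Coinvariants.hom_ext (LinearMap.ext fun v => ?_)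
    change Representation.normalizedJacquetGL F (lastBlockLabel 2) W t (ζbar d (Representation.Coinvariants.mk _ v)) =
        ζbar d (Representation.normalizedJacquetGL F (lastBlockLabel 2) W t (Representation.Coinvariants.mk _ v))
    rw [hζbar, Representation.normalizedJacquetGL_mk, Representation.normalizedJacquetGL_mk, map_smul, hζbar, ← Module.End.mul_apply, hWζ, Module.End.mul_apply]
  refine ⟨MonoidHom.noncommCoprod _ ζbar hcomm, fun t => ?_, fun d v => ?_⟩
  · show Representation.normalizedJacquetGL F (lastBlockLabel 2) W t * ζbar 1 = _
    rw [ζbar.map_one, mul_one]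
  · have h1 : (MonoidHom.noncommCoprod (Representation.normalizedJacquetGL F (lastBlockLabel 2) W) ζbar hcomm) (1, d) (Representation.Coinvariants.mk _ v) =
        Representation.normalizedJacquetGL F (lastBlockLabel 2) W 1 (Representation.Coinvariants.mk (Representation.restrictUnipotentGL F (lastBlockLabel 2) W) (ζ d v)) := rfl
    refine h1.trans ?_
    simp only [map_one, Module.End.one_apply]

end ProdRep

end Summit.HodgeConjecture.HodgeConjecture.Cruxes.H413.K2E3GL2JacquetProdRep

end
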